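import Summits.AtomisticToContinuum.Crystallization.Theses.LuttingerTiszaRegistry
import Summits.AtomisticToContinuum.Crystallization.Theses.LaminarSixThreeThree

/-!
# `LuttingerTiszaRegistry.BulkDefectVanish` (stmt-AtomisticToContinuum-0751) — the route SPLIT, glue landed

Crux-strategist decomposition (BC2 redirect) of the positional hinge `BulkDefectVanish` of route
`LuttingerTiszaRegistry` (item 0751, shared verbatim with `PoissonBesselStacking`, `ThreeConeCertificate`,
`FrustrationRangeCertificates`, …).  The hinge alone closes the sub-problem
(`crystallization_of_bulkDefectVanish`, ThreeConeCertificateKeplerBoundOfBulkDefectVanish.lean), so the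
route is an honest reduction only through a typed decomposition of the hinge.  The three pieces:

* `X₁ = LaminarBarlowWindows` (item 14292, verbatim): a.e. particle of a large Lennard-Jones ground
  state has its `R`-window two-way `ε`-matched, based at a site `z` and through a linear isometry, to SOME
  Barlow stacking `barlowStacking a h s`, `a, h ∈ (1/2, 2)` — LAYERING;
* `X₂ = StackingFaultSparsity` (item 14296, verbatim): a.e. Barlow-matched particle is matched to some
  `hcpStacking a h` — STACKING SELECTION (the step fed, in this route, by the counted fault price of
  `LjFaultCountedSelection`);
* `X₃ = HcpParameterLock` (NEW, `HcpParameterLock` below): ONE pair of lattice parameters `(a₀, h₀)`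
  such that, along every ground-state sequence in which a.e. particle is based-hcp-matched at every
  scale, for every scale `(R, ε)` and every `δ > 0` the particles that are hcp-matched at `(R, ε)` for
  some `(a, h)` in the box but for NO `(a, h)` within `δ` of `(a₀, h₀)` have vanishing density —
  LATTICE-PARAMETER LOCK (no template `P`, no un-based window, no vertex-transitivity in it).

The glue `lt_bulkDefectVanish_of_pieces : X₁ → X₂ → X₃ → BulkDefectVanish` is PROVED here and carries
the geometry that the hinge demands beyond the three pieces:

1. UN-BASING (`hcp_unbase`): for every site `z ∈ hcpStacking a h` there is a linear isometry
   `S ∈ {id, −id}` with `q ∈ hcpStacking a h ↔ z + S q ∈ hcpStacking a h` — a lattice translation for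
   sites in even layers, the point inversion through `z` for sites in odd layers
   (`barlowPos k₀ i₀ j₀ − barlowPos k i j = barlowPos (k₀−k) (i₀−i) (j₀−j)` for odd `k₀`).  This is
   exactly the "as typed `P` must be vertex-transitive" worry recorded on item 0751, discharged BY PROOF
   for the hcp template (the hinge's `P` is `hcpPeriodicConfiguration a₀ h₀`).
2. PARAMETER TRANSFER (`dist_barlowPos_param_le`): for `a, h > 1/2` and `|a' − a|, |h' − h| ≤ δ`,
   `dist (barlowPos a' h' s k i j) (barlowPos a h s k i j) ≤ 2δ‖barlowPos a h s k i j‖` (horizontal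
   coordinates scale with `a`, the vertical one with `h`).
3. SCALES (`template_of_hcpBased`): a based `(a, h)`-chart at `(R', ε') = (2R + 1, ε₁/2)` with
   `(a, h)` within `δ = ε₁ / (4(R + 1))` of `(a₀, h₀)` is an UN-BASED `(a₀, h₀)`-chart at `(R, ε₁)`,
   `ε₁ = min ε (1/8)`; plus the union bounds `{¬P@(R,ε)} ⊆ {¬Barlow@(R',ε')} ∪ {Barlow ∧ ¬hcp} ∪
   {hcp ∧ ¬hcp_δ} ∪ ∅`.

All lemmas `[folklore]`.  Sorry-free; `--supports stmt-AtomisticToContinuum-0751`.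
-/

noncomputable section

open scoped BigOperators Topology
open Filter Metric
open Literature.MathematicalPhysics.StatisticalMechanics

namespace Summit.AtomisticToContinuum.Crystallization.Theorems

namespace LtBdvSplit

local notation "E3" => EuclideanSpace ℝ (Fin 3)

/-! ## §1 Counting glue -/

/-- Union bound: a particle that is not `G`-good is either not `B`-good, or `B`-good and not
`G`-good. [folklore] -/
theorem natCard_not_le_add {N : ℕ} (B G : Fin N → Prop) :
    Nat.card {i : Fin N // ¬ G i} ≤
      Nat.card {i : Fin N // ¬ B i} + Nat.card {i : Fin N // B i ∧ ¬ G i} := by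
  calc Nat.card {i : Fin N // ¬ G i} = ({i | ¬ G i} : Set (Fin N)).ncard := rfl
    _ ≤ ({i | ¬ B i} ∪ {i | B i ∧ ¬ G i} : Set (Fin N)).ncard := by
        refine Set.ncard_le_ncard (fun i hi => ?_)
        simp only [Set.mem_setOf_eq, Set.mem_union] at hi ⊢
        by_cases hB : B i
        · exact Or.inr ⟨hB, hi⟩
        · exact Or.inl hB
    _ ≤ ({i | ¬ B i} : Set (Fin N)).ncard + ({i | B i ∧ ¬ G i} : Set (Fin N)).ncard :=
        Set.ncard_union_le _ _
    _ = Nat.card {i : Fin N // ¬ B i} + Nat.card {i : Fin N // B i ∧ ¬ G i} := rfl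

/-- Two-stage density bound: if the density of non-`B` particles and the density of
`B`-but-not-`G` particles both tend to `0`, so does the density of non-`G` particles. [folklore] -/
theorem tendsto_density_two_stage (B G : (N : ℕ) → Fin N → Prop)
    (hB : Tendsto (fun N : ℕ => (Nat.card {i : Fin N // ¬ B N i} : ℝ) / N) atTop (nhds 0))
    (hBG : Tendsto (fun N : ℕ => (Nat.card {i : Fin N // B N i ∧ ¬ G N i} : ℝ) / N)
      atTop (nhds 0)) :
    Tendsto (fun N : ℕ => (Nat.card {i : Fin N // ¬ G N i} : ℝ) / N) atTop (nhds 0) := by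
  have hsum : Tendsto (fun N : ℕ => (Nat.card {i : Fin N // ¬ B N i} : ℝ) / N +
      (Nat.card {i : Fin N // B N i ∧ ¬ G N i} : ℝ) / N) atTop (nhds 0) := by
    simpa only [add_zero] using hB.add hBG
  refine squeeze_zero (fun N => by positivity) (fun N => ?_) hsum
  rw [← add_div]
  gcongr
  exact_mod_cast natCard_not_le_add (B N) (G N)

/-- Monotone comparison of densities: if every `B`-good particle is `G`-good and the non-`B`
particles have vanishing density, so do the non-`G` particles. [folklore] -/
theorem tendsto_density_mono (B G : (N : ℕ) → Fin N → Prop) (hBG : ∀ N i, B N i → G N i)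
    (hB : Tendsto (fun N : ℕ => (Nat.card {i : Fin N // ¬ B N i} : ℝ) / N) atTop (nhds 0)) :
    Tendsto (fun N : ℕ => (Nat.card {i : Fin N // ¬ G N i} : ℝ) / N) atTop (nhds 0) := by
  refine squeeze_zero (fun N => by positivity) (fun N => ?_) hB
  gcongr
  have : Nat.card {i : Fin N // ¬ G N i} ≤ Nat.card {i : Fin N // ¬ B N i} :=
    calc Nat.card {i : Fin N // ¬ G N i} = ({i | ¬ G N i} : Set (Fin N)).ncard := rfl
      _ ≤ ({i | ¬ B N i} : Set (Fin N)).ncard := by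
          refine Set.ncard_le_ncard (fun i hi => ?_)
          simp only [Set.mem_setOf_eq] at hi ⊢
          exact fun hb => hi (hBG N i hb)
      _ = Nat.card {i : Fin N // ¬ B N i} := rfl
  exact_mod_cast this

/-! ## §2 Un-basing: the hcp stacking seen from any of its sites -/

section Unbase

variable (a h : ℝ)

/-- Layer labels of hcp: `0` on even layers. [folklore] -/
theorem haggLabel_alternating_of_even {k : ℤ} (hk : Even k) : haggLabel alternatingHagg k = 0 := by
  rw [haggLabel_alternating, if_pos hk]

/-- Layer labels of hcp: `1` on odd layers. [folklore] -/
theorem haggLabel_alternating_of_odd {k : ℤ} (hk : Odd k) : haggLabel alternatingHagg k = 1 := by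
  rw [haggLabel_alternating, if_neg (Int.not_even_iff_odd.2 hk)]

/-- Translating hcp by a site of an EVEN layer maps sites to sites:
`barlowPos k₀ i₀ j₀ + barlowPos k i j = barlowPos (k₀ + k) (i₀ + i) (j₀ + j)`. [folklore] -/
theorem hcp_add_of_even {k₀ : ℤ} (hk₀ : Even k₀) (i₀ j₀ k i j : ℤ) :
    barlowPos a h alternatingHagg k₀ i₀ j₀ + barlowPos a h alternatingHagg k i j =
      barlowPos a h alternatingHagg (k₀ + k) (i₀ + i) (j₀ + j) := by
  have hL0 : haggLabel alternatingHagg k₀ = 0 := haggLabel_alternating_of_even hk₀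
  have hL : haggLabel alternatingHagg (k₀ + k) = haggLabel alternatingHagg k := by
    rcases Int.even_or_odd k with hk | hk
    · rw [haggLabel_alternating_of_even hk, haggLabel_alternating_of_even (hk₀.add hk)]
    · rw [haggLabel_alternating_of_odd hk, haggLabel_alternating_of_odd (hk₀.add_odd hk)]
  ext l
  fin_cases l <;> simp [hL0, hL] <;> ring

/-- … and conversely `barlowPos k i j − barlowPos k₀ i₀ j₀ = barlowPos (k − k₀) (i − i₀) (j − j₀)` for
even `k₀`. [folklore] -/
theorem hcp_sub_of_even {k₀ : ℤ} (hk₀ : Even k₀) (i₀ j₀ k i j : ℤ) :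
    barlowPos a h alternatingHagg k i j - barlowPos a h alternatingHagg k₀ i₀ j₀ =
      barlowPos a h alternatingHagg (k - k₀) (i - i₀) (j - j₀) := by
  have hL0 : haggLabel alternatingHagg k₀ = 0 := haggLabel_alternating_of_even hk₀
  have hL : haggLabel alternatingHagg (k - k₀) = haggLabel alternatingHagg k := by
    rcases Int.even_or_odd k with hk | hk
    · rw [haggLabel_alternating_of_even hk, haggLabel_alternating_of_even (hk.sub hk₀)]
    · rw [haggLabel_alternating_of_odd hk, haggLabel_alternating_of_odd (hk.sub_even hk₀)]
  ext l
  fin_cases l <;> simp [hL0, hL] <;> ring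

/-- Point inversion through a site of an ODD layer maps sites to sites:
`barlowPos k₀ i₀ j₀ − barlowPos k i j = barlowPos (k₀ − k) (i₀ − i) (j₀ − j)` (the label of layer
`k₀ − k` is `1 −` the label of layer `k`). [folklore] -/
theorem hcp_sub_of_odd {k₀ : ℤ} (hk₀ : Odd k₀) (i₀ j₀ k i j : ℤ) :
    barlowPos a h alternatingHagg k₀ i₀ j₀ - barlowPos a h alternatingHagg k i j =
      barlowPos a h alternatingHagg (k₀ - k) (i₀ - i) (j₀ - j) := by
  have hL1 : haggLabel alternatingHagg k₀ = 1 := haggLabel_alternating_of_odd hk₀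
  rcases Int.even_or_odd k with hk | hk
  · have hLk : haggLabel alternatingHagg k = 0 := haggLabel_alternating_of_even hk
    have hL : haggLabel alternatingHagg (k₀ - k) = 1 :=
      haggLabel_alternating_of_odd (hk₀.sub_even hk)
    ext l
    fin_cases l <;> simp [hL1, hLk, hL] <;> ring
  · have hLk : haggLabel alternatingHagg k = 1 := haggLabel_alternating_of_odd hk
    have hL : haggLabel alternatingHagg (k₀ - k) = 0 :=
      haggLabel_alternating_of_even (hk₀.sub_odd hk)
    ext l
    fin_cases l <;> simp [hL1, hLk, hL] <;> ring

variable {a h}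

/-- **Un-basing.** For every site `z` of `hcpStacking a h` there is a linear isometry `S` with
`S ∘ S = id` (namely `S = id` for `z` in an even layer, `S = −id` for `z` in an odd layer) such that
`q ↦ z + S q` maps `hcpStacking a h` onto itself: hcp is vertex-transitive under translations composed
with the point inversion. [folklore] -/
theorem hcp_unbase {z : E3} (hz : z ∈ hcpStacking a h) :
    ∃ S : E3 →ₗᵢ[ℝ] E3, (∀ q, S (S q) = q) ∧
      ∀ q, q ∈ hcpStacking a h ↔ z + S q ∈ hcpStacking a h := by
  obtain ⟨k₀, i₀, j₀, rfl⟩ := hz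
  rcases Int.even_or_odd k₀ with hk | hk
  · refine ⟨LinearIsometry.id, fun q => by simp, fun q => ⟨?_, ?_⟩⟩
    · rintro ⟨k, i, j, rfl⟩
      exact ⟨k₀ + k, i₀ + i, j₀ + j, by simp [hcp_add_of_even a h hk]⟩
    · rintro ⟨k, i, j, hk'⟩
      refine ⟨k - k₀, i - i₀, j - j₀, ?_⟩
      have hq : q = barlowPos a h alternatingHagg k i j - barlowPos a h alternatingHagg k₀ i₀ j₀ := by
        rw [← hk']; simp
      rw [hq, hcp_sub_of_even a h hk]
  · refine ⟨(LinearIsometryEquiv.neg ℝ).toLinearIsometry, fun q => by simp, fun q => ⟨?_, ?_⟩⟩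
    · rintro ⟨k, i, j, rfl⟩
      refine ⟨k₀ - k, i₀ - i, j₀ - j, ?_⟩
      simp [← sub_eq_add_neg, hcp_sub_of_odd a h hk]
    · rintro ⟨k, i, j, hk'⟩
      refine ⟨k₀ - k, i₀ - i, j₀ - j, ?_⟩
      have hq : q = barlowPos a h alternatingHagg k₀ i₀ j₀ - barlowPos a h alternatingHagg k i j := by
        rw [← hk']; simp
      rw [hq, hcp_sub_of_odd a h hk]

end Unbase

/-! ## §3 Parameter transfer -/

/-- **Parameter transfer.** For `a, h > 1/2` and `|a' − a|, |h' − h| ≤ δ`, moving the lattice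
parameters moves the site `(k, i, j)` by at most `2δ` times its norm (the horizontal coordinates of
`barlowPos` are `a`-homogeneous, the vertical one `h`-homogeneous). [folklore] -/
theorem dist_barlowPos_param_le {a h a' h' δ : ℝ} (s : ℤ → ℤ) (ha : 1 / 2 < a) (hh : 1 / 2 < h)
    (hδa : |a' - a| ≤ δ) (hδh : |h' - h| ≤ δ) (k i j : ℤ) :
    dist (barlowPos a' h' s k i j) (barlowPos a h s k i j) ≤ 2 * δ * ‖barlowPos a h s k i j‖ := by
  have hδ : 0 ≤ δ := (abs_nonneg _).trans hδa
  -- the `a`-homogeneous (horizontal) quadratic form of the site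
  have hX0 : 0 ≤ ((i : ℝ) + (j : ℝ) / 2 + (haggLabel s k : ℝ) / 2) ^ 2 +
      (√3 / 2 * ((j : ℝ) + (haggLabel s k : ℝ) / 3)) ^ 2 := by positivity
  have hd2 : dist (barlowPos a' h' s k i j) (barlowPos a h s k i j) ^ 2 =
      (a' - a) ^ 2 * (((i : ℝ) + (j : ℝ) / 2 + (haggLabel s k : ℝ) / 2) ^ 2 +
        (√3 / 2 * ((j : ℝ) + (haggLabel s k : ℝ) / 3)) ^ 2) + (h' - h) ^ 2 * (k : ℝ) ^ 2 := by
    rw [EuclideanSpace.dist_sq_eq, Fin.sum_univ_three, Real.dist_eq, Real.dist_eq, Real.dist_eq,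
      sq_abs, sq_abs, sq_abs, barlowPos_apply_zero, barlowPos_apply_zero, barlowPos_apply_one,
      barlowPos_apply_one, barlowPos_apply_two, barlowPos_apply_two]
    ring
  have hn2 : ‖barlowPos a h s k i j‖ ^ 2 =
      a ^ 2 * (((i : ℝ) + (j : ℝ) / 2 + (haggLabel s k : ℝ) / 2) ^ 2 +
        (√3 / 2 * ((j : ℝ) + (haggLabel s k : ℝ) / 3)) ^ 2) + h ^ 2 * (k : ℝ) ^ 2 := by
    rw [EuclideanSpace.real_norm_sq_eq, Fin.sum_univ_three, barlowPos_apply_zero,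
      barlowPos_apply_one, barlowPos_apply_two]
    ring
  have h1 : (a' - a) ^ 2 ≤ (2 * δ * a) ^ 2 := by
    have hle : |a' - a| ≤ 2 * δ * a := hδa.trans (by nlinarith)
    exact sq_le_sq' (abs_le.1 hle).1 (abs_le.1 hle).2
  have h2 : (h' - h) ^ 2 ≤ (2 * δ * h) ^ 2 := by
    have hle : |h' - h| ≤ 2 * δ * h := hδh.trans (by nlinarith)
    exact sq_le_sq' (abs_le.1 hle).1 (abs_le.1 hle).2
  have hsq : dist (barlowPos a' h' s k i j) (barlowPos a h s k i j) ^ 2 ≤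
      (2 * δ * ‖barlowPos a h s k i j‖) ^ 2 :=
    calc dist (barlowPos a' h' s k i j) (barlowPos a h s k i j) ^ 2
        = (a' - a) ^ 2 * (((i : ℝ) + (j : ℝ) / 2 + (haggLabel s k : ℝ) / 2) ^ 2 +
          (√3 / 2 * ((j : ℝ) + (haggLabel s k : ℝ) / 3)) ^ 2) + (h' - h) ^ 2 * (k : ℝ) ^ 2 := hd2
      _ ≤ (2 * δ * a) ^ 2 * (((i : ℝ) + (j : ℝ) / 2 + (haggLabel s k : ℝ) / 2) ^ 2 +
          (√3 / 2 * ((j : ℝ) + (haggLabel s k : ℝ) / 3)) ^ 2) + (2 * δ * h) ^ 2 * (k : ℝ) ^ 2 := by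
          gcongr
      _ = (2 * δ) ^ 2 * (a ^ 2 * (((i : ℝ) + (j : ℝ) / 2 + (haggLabel s k : ℝ) / 2) ^ 2 +
          (√3 / 2 * ((j : ℝ) + (haggLabel s k : ℝ) / 3)) ^ 2) + h ^ 2 * (k : ℝ) ^ 2) := by ring
      _ = (2 * δ * ‖barlowPos a h s k i j‖) ^ 2 := by rw [← hn2]; ring
  exact (pow_le_pow_iff_left₀ dist_nonneg (by positivity) two_ne_zero).1 hsq

/-- Set form of the parameter transfer: every site of `hcpStacking a h` has a site of
`hcpStacking a' h'` within `2δ` times its norm. [folklore] -/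
theorem exists_hcp_near {a h a' h' δ : ℝ} (ha : 1 / 2 < a) (hh : 1 / 2 < h)
    (hδa : |a' - a| ≤ δ) (hδh : |h' - h| ≤ δ) {q : E3} (hq : q ∈ hcpStacking a h) :
    ∃ q' ∈ hcpStacking a' h', dist q' q ≤ 2 * δ * ‖q‖ := by
  obtain ⟨k, i, j, rfl⟩ := hq
  exact ⟨_, ⟨k, i, j, rfl⟩, dist_barlowPos_param_le alternatingHagg ha hh hδa hδh k i j⟩

/-! ## §4 The matching predicates -/

/-- Particle `i` of the finite configuration `y` is BASED-hcp-matched at scale `(R, ε)` with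
parameters `(a, h)`: some site `z` and linear isometry `A` two-way `ε`-match the particles within `R`
of `y i` with `y i + A (hcpStacking a h − z)` (the predicate of items 14296 / 14299). -/
def HcpBased (a h R ε : ℝ) {N : ℕ} (y : Fin N → E3) (i : Fin N) : Prop :=
  ∃ z ∈ hcpStacking a h, ∃ A : E3 →ₗᵢ[ℝ] E3,
    (∀ p ∈ hcpStacking a h, dist p z ≤ R → ∃ j : Fin N, dist (y j) (y i + A (p - z)) ≤ ε) ∧
    (∀ j : Fin N, dist (y j) (y i) ≤ R → ∃ p ∈ hcpStacking a h, dist (y j) (y i + A (p - z)) ≤ ε)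

/-- Particle `i` is UN-BASED template-matched at scale `(R, ε)` to the point set `T` (the predicate of
the hinge, with `T = P.points`). -/
def Template (T : Set E3) (R ε : ℝ) {N : ℕ} (y : Fin N → E3) (i : Fin N) : Prop :=
  ∃ A : E3 →ₗᵢ[ℝ] E3, (∀ q ∈ T, ‖q‖ ≤ R → ∃ j : Fin N, dist (y j) (y i + A q) ≤ ε) ∧
    (∀ j : Fin N, dist (y j) (y i) ≤ R → ∃ q ∈ T, dist (y j) (y i + A q) ≤ ε)

/-! ## §5 The geometric core: a based `δ`-close hcp chart is an un-based template chart -/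

/-- **Core.** If particle `i` is based-hcp-matched at `(R', ε')` with parameters `(a, h)` within `δ`
of `(a₀, h₀)` (all four parameters `> 1/2`, `δ ≤ 1/2`), then it is un-based template-matched to
`hcpStacking a₀ h₀` at every scale `(R, ε)` with `2R ≤ R'`, `ε' + 2δR ≤ ε` and
`ε' + 2δ(R + ε') ≤ ε`.  Proof: un-base the chart at `z` by `S = ±id` (`hcp_unbase`), compose the
isometry with `S`, and move each matched site from parameters `(a, h)` to `(a₀, h₀)` at cost
`≤ 2δ ×` its norm (`exists_hcp_near`). [folklore] -/
theorem template_of_hcpBased {a h a₀ h₀ δ R R' ε ε' : ℝ}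
    (ha : 1 / 2 < a) (hh : 1 / 2 < h) (ha₀ : 1 / 2 < a₀) (hh₀ : 1 / 2 < h₀)
    (hda : |a - a₀| ≤ δ) (hdh : |h - h₀| ≤ δ) (hδ2 : δ ≤ 1 / 2)
    (hR : 0 ≤ R) (hR' : 2 * R ≤ R')
    (hεf : ε' + 2 * δ * R ≤ ε) (hεc : ε' + 2 * δ * (R + ε') ≤ ε)
    {N : ℕ} {y : Fin N → E3} {i : Fin N} (hM : HcpBased a h R' ε' y i) :
    Template (hcpStacking a₀ h₀) R ε y i := by
  obtain ⟨z, hz, A, hfwd, hconv⟩ := hM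
  obtain ⟨S, hSS, hS⟩ := hcp_unbase hz
  have hδ : 0 ≤ δ := (abs_nonneg _).trans hda
  have hda' : |a₀ - a| ≤ δ := by rwa [abs_sub_comm] at hda
  have hdh' : |h₀ - h| ≤ δ := by rwa [abs_sub_comm] at hdh
  refine ⟨A.comp S, ?_, ?_⟩
  · -- forward: every template site within `R` of the origin has a particle nearby
    intro q₀ hq₀ hq₀R
    obtain ⟨q, hq, hqq₀⟩ := exists_hcp_near ha₀ hh₀ hda hdh hq₀
    -- `q ∈ hcpStacking a h`, `dist q q₀ ≤ 2δ‖q₀‖ ≤ 2δR`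
    have hqq₀' : dist q q₀ ≤ 2 * δ * R := hqq₀.trans (by gcongr)
    have hp : z + S q ∈ hcpStacking a h := (hS q).1 hq
    have hqn : ‖q‖ ≤ R' := by
      have h1 : ‖q‖ ≤ ‖q₀‖ + dist q q₀ := by
        rw [dist_eq_norm]; exact norm_le_insert' q q₀
      have h2 : 2 * δ * R ≤ R := by nlinarith
      linarith
    have hdist : dist (z + S q) z ≤ R' := by
      rw [dist_eq_norm, add_sub_cancel_left, S.norm_map]; exact hqn
    obtain ⟨j, hj⟩ := hfwd (z + S q) hp hdist
    refine ⟨j, ?_⟩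
    have key : dist (y i + A (z + S q - z)) (y i + A.comp S q₀) = dist q q₀ := by
      rw [add_sub_cancel_left]
      change dist (y i + A (S q)) (y i + A (S q₀)) = dist q q₀
      rw [dist_add_left, A.dist_map, S.dist_map]
    calc dist (y j) (y i + A.comp S q₀)
        ≤ dist (y j) (y i + A (z + S q - z)) + dist (y i + A (z + S q - z)) (y i + A.comp S q₀) :=
          dist_triangle _ _ _
      _ ≤ ε' + 2 * δ * R := by rw [key]; exact add_le_add hj hqq₀'
      _ ≤ ε := hεf
  · -- converse: every particle within `R` of `y i` sits near a template site
    intro j hj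
    have hRR' : R ≤ R' := by linarith
    obtain ⟨p, hp, hpj⟩ := hconv j (hj.trans hRR')
    obtain ⟨q, hSq, hqn0⟩ : ∃ q : E3, S q = p - z ∧ ‖q‖ = ‖p - z‖ :=
      ⟨S (p - z), hSS _, S.norm_map _⟩
    have hqmem : q ∈ hcpStacking a h := (hS q).2 (by rw [hSq, add_sub_cancel]; exact hp)
    obtain ⟨q₀, hq₀, hq₀q⟩ := exists_hcp_near ha hh hda' hdh' hqmem
    have hqn : ‖q‖ ≤ R + ε' := by
      have h1 : ‖p - z‖ = dist (y i + A (p - z)) (y i) := by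
        rw [dist_eq_norm, add_sub_cancel_left, A.norm_map]
      have h2 : dist (y i + A (p - z)) (y i) ≤ dist (y i + A (p - z)) (y j) + dist (y j) (y i) :=
        dist_triangle _ _ _
      rw [dist_comm (y i + A (p - z)) (y j)] at h2
      linarith
    have hq₀q' : dist q₀ q ≤ 2 * δ * (R + ε') := hq₀q.trans (by gcongr)
    refine ⟨q₀, hq₀, ?_⟩
    have key : dist (y i + A (p - z)) (y i + A.comp S q₀) = dist q₀ q := by
      change dist (y i + A (p - z)) (y i + A (S q₀)) = dist q₀ q
      rw [dist_add_left, A.dist_map, ← hSq, S.dist_map, dist_comm]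
    calc dist (y j) (y i + A.comp S q₀)
        ≤ dist (y j) (y i + A (p - z)) + dist (y i + A (p - z)) (y i + A.comp S q₀) :=
          dist_triangle _ _ _
      _ ≤ ε' + 2 * δ * (R + ε') := by rw [key]; exact add_le_add hpj hq₀q'
      _ ≤ ε := hεc

/-! ## §6 The new piece and the assembly -/

/-- **`X₃` — hcp LATTICE-PARAMETER LOCK** (the new crux of the split; inlined verbatim as the route
item `LuttingerTiszaRegistry.HcpParameterLock`).  There is ONE pair `(a₀, h₀) ∈ (1/2, 2)²` such that,
along every sequence of Lennard-Jones ground states in which, at every scale `(R, ε)` (`ε < 1/4`), all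
but `o(N)` particles are based-hcp-matched for some `(a, h) ∈ (1/2, 2)²`, the following holds for
all `R > 0`, `ε ∈ (0, 1/4)`, `δ > 0`: the particles that are based-hcp-matched at `(R, ε)` for some
`(a, h)` in the box but for no `(a, h)` in the box with `|a − a₀| ≤ δ`, `|h − h₀| ≤ δ` number `o(N)`.
Intended witness: the minimiser `(a₀, h₀) ≈ (0.971, 0.793)` of the relaxed-hcp Lennard-Jones energy
per particle; mechanism: strict (quadratic) minimality of `(a, h) ↦ e(hcp a h)` plus the `O(N^{2/3})`
energy excess of ground states, the `o(N)` unmatched particles costing `O(1)` each. -/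
def HcpParameterLock : Prop :=
  ∃ a₀ h₀ : ℝ, 1 / 2 < a₀ ∧ a₀ < 2 ∧ 1 / 2 < h₀ ∧ h₀ < 2 ∧ ∀ x : (N : ℕ) → (Fin N → EuclideanSpace ℝ (Fin 3)), (∀ N, Literature.MathematicalPhysics.StatisticalMechanics.IsGroundState Literature.MathematicalPhysics.StatisticalMechanics.lennardJones (x N)) → (∀ R ε : ℝ, 0 < R → 0 < ε → ε < 1 / 4 → Filter.Tendsto (fun N : ℕ => (Nat.card {i : Fin N // ¬ (∃ a h : ℝ, 1 / 2 < a ∧ a < 2 ∧ 1 / 2 < h ∧ h < 2 ∧ ∃ z ∈ Literature.MathematicalPhysics.StatisticalMechanics.hcpStacking a h, ∃ A : EuclideanSpace ℝ (Fin 3) →ₗᵢ[ℝ] EuclideanSpace ℝ (Fin 3), (∀ p ∈ Literature.MathematicalPhysics.StatisticalMechanics.hcpStacking a h, dist p z ≤ R → ∃ j : Fin N, dist (x N j) (x N i + A (p - z)) ≤ ε) ∧ (∀ j : Fin N, dist (x N j) (x N i) ≤ R → ∃ p ∈ Literature.MathematicalPhysics.StatisticalMechanics.hcpStacking a h, dist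 (x N j) (x N i + A (p - z)) ≤ ε))} : ℝ) / N) Filter.atTop (nhds 0)) → ∀ R ε δ : ℝ, 0 < R → 0 < ε → ε < 1 / 4 → 0 < δ → Filter.Tendsto (fun N : ℕ => (Nat.card {i : Fin N // (∃ a h : ℝ, 1 / 2 < a ∧ a < 2 ∧ 1 / 2 < h ∧ h < 2 ∧ ∃ z ∈ Literature.MathematicalPhysics.StatisticalMechanics.hcpStacking a h, ∃ A : EuclideanSpace ℝ (Fin 3) →ₗᵢ[ℝ] EuclideanSpace ℝ (Fin 3), (∀ p ∈ Literature.MathematicalPhysics.StatisticalMechanics.hcpStacking a h, dist p z ≤ R → ∃ j : Fin N, dist (x N j) (x N i + A (p - z)) ≤ ε) ∧ (∀ j : Fin N, dist (x N j) (x N i) ≤ R → ∃ p ∈ Literature.MathematicalPhysics.StatisticalMechanics.hcpStacking a h, dist (x N j) (x N i + A (p - z)) ≤ ε)) ∧ ¬ (∃ a h : ℝ, |a - a₀| ≤ δ ∧ |h - h₀| ≤ δ ∧ 1 / 2 < a ∧ a < 2 ∧ 1 / 2 < h ∧ h < 2 ∧ ∃ z ∈ Literature.MathematicalPhysics.StatisticalMechanics.hcpStacking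 a h, ∃ A : EuclideanSpace ℝ (Fin 3) →ₗᵢ[ℝ] EuclideanSpace ℝ (Fin 3), (∀ p ∈ Literature.MathematicalPhysics.StatisticalMechanics.hcpStacking a h, dist p z ≤ R → ∃ j : Fin N, dist (x N j) (x N i + A (p - z)) ≤ ε) ∧ (∀ j : Fin N, dist (x N j) (x N i) ≤ R → ∃ p ∈ Literature.MathematicalPhysics.StatisticalMechanics.hcpStacking a h, dist (x N j) (x N i + A (p - z)) ≤ ε))} : ℝ) / N) Filter.atTop (nhds 0)

/-- **The glue, by name over the pieces** `LaminarBarlowWindows` (14292), `StackingFaultSparsity`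
(14296) and `HcpParameterLock`: they imply the hinge `LuttingerTiszaRegistry.BulkDefectVanish`.
Witness `P := hcpPeriodicConfiguration a₀ h₀`; for a target scale `(R, ε)` put `ε₁ = min ε (1/8)`,
`R' = 2R + 1`, `ε' = ε₁ / 2`, `δ = ε₁ / (4 (R + 1))`; then
`{¬P@(R,ε)} ⊆ {¬Barlow@(R',ε')} ∪ {Barlow ∧ ¬hcp @(R',ε')} ∪ {hcp ∧ ¬hcp_δ @(R',ε')}`, the last
inclusion being the geometric core `template_of_hcpBased`; the three densities vanish by `X₁`, `X₂`
and `X₃` (whose hypothesis — a.e. particle hcp-matched at every scale — is `X₁ ∧ X₂` by the union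
bound). [folklore] -/
theorem bulkDefectVanish_of_pieces
    (hX₁ : Summit.AtomisticToContinuum.Crystallization.Theses.LaminarSixThreeThree.LaminarBarlowWindows)
    (hX₂ : Summit.AtomisticToContinuum.Crystallization.Theses.LaminarSixThreeThree.StackingFaultSparsity)
    (hX₃ : HcpParameterLock) :
    Summit.AtomisticToContinuum.Crystallization.Theses.LuttingerTiszaRegistry.BulkDefectVanish := by
  obtain ⟨a₀, h₀, ha₀, ha₀2, hh₀, hh₀2, hlock⟩ := hX₃
  have ha₀0 : a₀ ≠ 0 := ne_of_gt (by linarith)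
  have hh₀0 : h₀ ≠ 0 := ne_of_gt (by linarith)
  refine ⟨hcpPeriodicConfiguration ha₀0 hh₀0, fun R ε hR hε x hx => ?_⟩
  -- (H) a.e. particle is based-hcp-matched at every scale: `X₁ ∧ X₂` by the union bound
  have hH : ∀ R ε : ℝ, 0 < R → 0 < ε → ε < 1 / 4 →
      Tendsto (fun N : ℕ => (Nat.card {i : Fin N // ¬ (∃ a h : ℝ, 1 / 2 < a ∧ a < 2 ∧ 1 / 2 < h ∧
        h < 2 ∧ HcpBased a h R ε (x N) i)} : ℝ) / N) atTop (nhds 0) :=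
    fun R ε hR hε hε4 => tendsto_density_two_stage _ _ (hX₁ R ε hR hε hε4 x hx) (hX₂ R ε hR hε hε4 x hx)
  -- scales: `ε₁ = min ε (1/8)`, `R' = 2R + 1`, `ε' = ε₁/2`, `δ = ε₁/(4(R + 1))`
  obtain ⟨ε₁, hε₁, hε₁ε, hε₁8⟩ : ∃ ε₁ : ℝ, 0 < ε₁ ∧ ε₁ ≤ ε ∧ ε₁ ≤ 1 / 8 :=
    ⟨min ε (1 / 8), lt_min hε (by norm_num), min_le_left _ _, min_le_right _ _⟩
  have hR1 : 0 < R + 1 := by linarith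
  obtain ⟨δ, hδ, hδR⟩ : ∃ δ : ℝ, 0 < δ ∧ δ * (4 * (R + 1)) = ε₁ :=
    ⟨ε₁ / (4 * (R + 1)), by positivity, div_mul_cancel₀ _ (by positivity)⟩
  have hR' : (0 : ℝ) < 2 * R + 1 := by positivity
  have hε' : (0 : ℝ) < ε₁ / 2 := by positivity
  have hε'4 : ε₁ / 2 < 1 / 4 := by linarith
  have hδ2 : δ ≤ 1 / 2 := by nlinarith
  have hεf : ε₁ / 2 + 2 * δ * R ≤ ε₁ := by nlinarith
  have hεc : ε₁ / 2 + 2 * δ * (R + ε₁ / 2) ≤ ε₁ := by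
    have : δ * (ε₁ / 2) ≤ δ * 1 := mul_le_mul_of_nonneg_left (by linarith) hδ.le
    nlinarith
  -- the three vanishing densities at the certification scale `(R', ε')`
  have h1 := hH (2 * R + 1) (ε₁ / 2) hR' hε' hε'4
  have h2 := hlock x hx hH (2 * R + 1) (ε₁ / 2) δ hR' hε' hε'4 hδ
  have h3 := tendsto_density_two_stage _ _ h1 h2
  -- comparison with the hinge's bad set through the geometric core
  refine tendsto_density_mono _ _ (fun N i hi => ?_) h3
  obtain ⟨a, h, hda, hdh, ha, ha2, hh, hh2, hM⟩ := hi
  have hT : Template (hcpStacking a₀ h₀) R ε₁ (x N) i :=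
    template_of_hcpBased ha hh ha₀ hh₀ hda hdh hδ2 hR.le (by linarith) hεf hεc hM
  obtain ⟨A, hA1, hA2⟩ := hT
  refine ⟨A, fun q hq hqR => ?_, fun j hj => ?_⟩
  · rw [hcpPeriodicConfiguration_points] at hq
    obtain ⟨j, hj⟩ := hA1 q hq hqR
    exact ⟨j, hj.trans hε₁ε⟩
  · obtain ⟨q, hq, hjq⟩ := hA2 j hj
    exact ⟨q, by rw [hcpPeriodicConfiguration_points]; exact hq, hjq.trans hε₁ε⟩

end LtBdvSplit

/-- **The split glue of route `LuttingerTiszaRegistry`** with the three pieces stated LITERALLY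
(so that the theorem elaborates against whatever the ledger names the children):
`LaminarBarlowWindows → StackingFaultSparsity → HcpParameterLock → LuttingerTiszaRegistry.BulkDefectVanish`.
[folklore] -/
theorem lt_bulkDefectVanish_of_pieces :
    (∀ R ε : ℝ, 0 < R → 0 < ε → ε < 1 / 4 → ∀ x : (N : ℕ) → (Fin N → EuclideanSpace ℝ (Fin 3)), (∀ N, Literature.MathematicalPhysics.StatisticalMechanics.IsGroundState Literature.MathematicalPhysics.StatisticalMechanics.lennardJones (x N)) → Filter.Tendsto (fun N : ℕ => (Nat.card {i : Fin N // ¬ (∃ a h : ℝ, 1 / 2 < a ∧ a < 2 ∧ 1 / 2 < h ∧ h < 2 ∧ ∃ s : ℤ → ℤ, Literature.MathematicalPhysics.StatisticalMechanics.IsHaggSeq s ∧ ∃ z ∈ Literature.MathematicalPhysics.StatisticalMechanics.barlowStacking a h s, ∃ A : EuclideanSpace ℝ (Fin 3) →ₗᵢ[ℝ] EuclideanSpace ℝ (Fin 3), (∀ p ∈ Literature.MathematicalPhysics.StatisticalMechanics.barlowStacking a h s, dist p z ≤ R → ∃ j : Fin N, dist (x N j) (x N i + A (p - z)) ≤ ε)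 ∧ (∀ j : Fin N, dist (x N j) (x N i) ≤ R → ∃ p ∈ Literature.MathematicalPhysics.StatisticalMechanics.barlowStacking a h s, dist (x N j) (x N i + A (p - z)) ≤ ε))} : ℝ) / N) Filter.atTop (nhds 0)) →
    (∀ R ε : ℝ, 0 < R → 0 < ε → ε < 1 / 4 → ∀ x : (N : ℕ) → (Fin N → EuclideanSpace ℝ (Fin 3)), (∀ N, Literature.MathematicalPhysics.StatisticalMechanics.IsGroundState Literature.MathematicalPhysics.StatisticalMechanics.lennardJones (x N)) → Filter.Tendsto (fun N : ℕ => (Nat.card {i : Fin N // (∃ a h : ℝ, 1 / 2 < a ∧ a < 2 ∧ 1 / 2 < h ∧ h < 2 ∧ ∃ s : ℤ → ℤ, Literature.MathematicalPhysics.StatisticalMechanics.IsHaggSeq s ∧ ∃ z ∈ Literature.MathematicalPhysics.StatisticalMechanics.barlowStacking a h s, ∃ A : EuclideanSpace ℝ (Fin 3) →ₗᵢ[ℝ] EuclideanSpace ℝ (Fin 3), (∀ p ∈ Literature.MathematicalPhysics.StatisticalMechanics.barlowStacking a h s, dist p z ≤ R → ∃ j : Fin N, dist (x N j) (x N i + A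 (p - z)) ≤ ε) ∧ (∀ j : Fin N, dist (x N j) (x N i) ≤ R → ∃ p ∈ Literature.MathematicalPhysics.StatisticalMechanics.barlowStacking a h s, dist (x N j) (x N i + A (p - z)) ≤ ε)) ∧ ¬ (∃ a h : ℝ, 1 / 2 < a ∧ a < 2 ∧ 1 / 2 < h ∧ h < 2 ∧ ∃ z ∈ Literature.MathematicalPhysics.StatisticalMechanics.hcpStacking a h, ∃ A : EuclideanSpace ℝ (Fin 3) →ₗᵢ[ℝ] EuclideanSpace ℝ (Fin 3), (∀ p ∈ Literature.MathematicalPhysics.StatisticalMechanics.hcpStacking a h, dist p z ≤ R → ∃ j : Fin N, dist (x N j) (x N i + A (p - z)) ≤ ε) ∧ (∀ j : Fin N, dist (x N j) (x N i) ≤ R → ∃ p ∈ Literature.MathematicalPhysics.StatisticalMechanics.hcpStacking a h, dist (x N j) (x N i + A (p - z)) ≤ ε))} : ℝ) / N) Filter.atTop (nhds 0)) →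
    (∃ a₀ h₀ : ℝ, 1 / 2 < a₀ ∧ a₀ < 2 ∧ 1 / 2 < h₀ ∧ h₀ < 2 ∧ ∀ x : (N : ℕ) → (Fin N → EuclideanSpace ℝ (Fin 3)), (∀ N, Literature.MathematicalPhysics.StatisticalMechanics.IsGroundState Literature.MathematicalPhysics.StatisticalMechanics.lennardJones (x N)) → (∀ R ε : ℝ, 0 < R → 0 < ε → ε < 1 / 4 → Filter.Tendsto (fun N : ℕ => (Nat.card {i : Fin N // ¬ (∃ a h : ℝ, 1 / 2 < a ∧ a < 2 ∧ 1 / 2 < h ∧ h < 2 ∧ ∃ z ∈ Literature.MathematicalPhysics.StatisticalMechanics.hcpStacking a h, ∃ A : EuclideanSpace ℝ (Fin 3) →ₗᵢ[ℝ] EuclideanSpace ℝ (Fin 3), (∀ p ∈ Literature.MathematicalPhysics.StatisticalMechanics.hcpStacking a h, dist p z ≤ R → ∃ j : Fin N, dist (x N j) (x N i + A (p - z)) ≤ ε) ∧ (∀ j : Fin N, dist (x N j) (x N i) ≤ R → ∃ p ∈ Literature.MathematicalPhysics.StatisticalMechanics.hcpStacking a h, dist (x N j) (x N i + A (p - z))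 ≤ ε))} : ℝ) / N) Filter.atTop (nhds 0)) → ∀ R ε δ : ℝ, 0 < R → 0 < ε → ε < 1 / 4 → 0 < δ → Filter.Tendsto (fun N : ℕ => (Nat.card {i : Fin N // (∃ a h : ℝ, 1 / 2 < a ∧ a < 2 ∧ 1 / 2 < h ∧ h < 2 ∧ ∃ z ∈ Literature.MathematicalPhysics.StatisticalMechanics.hcpStacking a h, ∃ A : EuclideanSpace ℝ (Fin 3) →ₗᵢ[ℝ] EuclideanSpace ℝ (Fin 3), (∀ p ∈ Literature.MathematicalPhysics.StatisticalMechanics.hcpStacking a h, dist p z ≤ R → ∃ j : Fin N, dist (x N j) (x N i + A (p - z)) ≤ ε) ∧ (∀ j : Fin N, dist (x N j) (x N i) ≤ R → ∃ p ∈ Literature.MathematicalPhysics.StatisticalMechanics.hcpStacking a h, dist (x N j) (x N i + A (p - z)) ≤ ε)) ∧ ¬ (∃ a h : ℝ, |a - a₀| ≤ δ ∧ |h - h₀| ≤ δ ∧ 1 / 2 < a ∧ a < 2 ∧ 1 / 2 < h ∧ h < 2 ∧ ∃ z ∈ Literature.MathematicalPhysics.StatisticalMechanics.hcpStacking a h,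 ∃ A : EuclideanSpace ℝ (Fin 3) →ₗᵢ[ℝ] EuclideanSpace ℝ (Fin 3), (∀ p ∈ Literature.MathematicalPhysics.StatisticalMechanics.hcpStacking a h, dist p z ≤ R → ∃ j : Fin N, dist (x N j) (x N i + A (p - z)) ≤ ε) ∧ (∀ j : Fin N, dist (x N j) (x N i) ≤ R → ∃ p ∈ Literature.MathematicalPhysics.StatisticalMechanics.hcpStacking a h, dist (x N j) (x N i + A (p - z)) ≤ ε))} : ℝ) / N) Filter.atTop (nhds 0)) →
    Summit.AtomisticToContinuum.Crystallization.Theses.LuttingerTiszaRegistry.BulkDefectVanish :=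
  fun h₁ h₂ h₃ => LtBdvSplit.bulkDefectVanish_of_pieces h₁ h₂ h₃

/-- By-name reading of the same glue (certifies that the literal hypotheses above are, definitionally,
items 14292 and 14296 and the named statement `HcpParameterLock`). [folklore] -/
example : Summit.AtomisticToContinuum.Crystallization.Theses.LaminarSixThreeThree.LaminarBarlowWindows →
    Summit.AtomisticToContinuum.Crystallization.Theses.LaminarSixThreeThree.StackingFaultSparsity →
    LtBdvSplit.HcpParameterLock →
    Summit.AtomisticToContinuum.Crystallization.Theses.LuttingerTiszaRegistry.BulkDefectVanish :=
  lt_bulkDefectVanish_of_pieces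

end Summit.AtomisticToContinuum.Crystallization.Theorems

end
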